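import Literature.MathematicalPhysics.QuantumFieldTheory.ConformalBootstrap3D.PointKernelK57Data

/-!
# K57 certificate, kernel block file H25: head segments `217 ≤ i < 231` (block-checked ones)

`decide` by kernel reduction (no `native_decide`, no extra axioms) of the block checker
`PCert.hBlockOK` of `PointKernel` on the literal data of `PointKernelK57Data` (cells checked corner
or chord by the rule bit); soundness is `PCert.hBlockOK_sound`.  Estimated kernel time 196 s
(4 theorems).
-/

set_option maxRecDepth 100000
set_option maxHeartbeats 0

namespace Literature.MathematicalPhysics.QuantumFieldTheory.ConformalBootstrap3D.PointKernelK57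

open Literature.MathematicalPhysics.QuantumFieldTheory.ConformalBootstrap3D.PointKernel

/-- head segments `[217, 220)` pass the kernel evaluator (≈49 s of kernel work). [folklore] -/
theorem hBlock_217 : certK57.hBlockOK hsegsK57 217 220 JHK57 = true := by
  decide +kernel

/-- head segments `[220, 229)` pass the kernel evaluator (≈13 s of kernel work). [folklore] -/
theorem hBlock_220 : certK57.hBlockOK hsegsK57 220 229 JHK57 = true := by
  decide +kernel

/-- head segment `[229, 230)` passes the kernel evaluator (≈38 s of kernel work). [folklore] -/
theorem hBlock_229 : certK57.hBlockOK hsegsK57 229 230 JHK57 = true := by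
  decide +kernel

/-- head segment `[230, 231)` passes the kernel evaluator (≈39 s of kernel work). [folklore] -/
theorem hBlock_230 : certK57.hBlockOK hsegsK57 230 231 JHK57 = true := by
  decide +kernel

end Literature.MathematicalPhysics.QuantumFieldTheory.ConformalBootstrap3D.PointKernelK57
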